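import Literature.Analysis.OperatorTheory.LocalSqrtNearOneProofs
import Mathlib.Analysis.Calculus.FDeriv.Analytic
import Mathlib.Analysis.Normed.Ring.Units

/-!
# The smooth square root near `1` in a Banach algebra: smoothness nearby, symmetries, invertibility

Complements to `LocalSqrtNearOneProofs.lean` (the local inverse `√` of squaring at `1` in a complete
normed `ℝ`-algebra `𝔸`, from the inverse function theorem):

* `contDiffAt_omega_localSqrt`: `√` is even analytic (`C^ω`) at `1` (squaring is), hence
  `eventually_contDiffAt_localSqrt`: `√` is `C^∞` at **every** point of a neighbourhood of `1`
  (analyticity propagates to a neighbourhood; pointwise `C^∞` at `1` alone would not);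
* `eventually_localSqrt_fixed_of_antihom` (**uniqueness ⇒ symmetry**): for a map `σ : 𝔸 → 𝔸` with
  `σ 1 = 1`, `σ (XY) = σ Y σ X`, continuous at `1` (an anti-homomorphism such as an adjoint /
  transpose with respect to a bilinear form), `σ X = X` implies `σ (√X) = √X` near `1`: the square
  root of a self-adjoint element is self-adjoint, for any notion of adjoint;
* `eventually_isUnit_localSqrt`: `√X` is invertible near `1`.

Used for the positive square root of the Gram operator of an osculating metric (Voisin (2002),
Prop. 3.14 / Prop. 6.5: Kähler identities in osculating coordinates).

## References

* C. Voisin, *Hodge Theory and Complex Algebraic Geometry I* (2002), Prop. 3.14, Prop. 6.5.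
  [Voisin2002]
* (Inverse function theorem, analytic case) Mathlib,
  `Mathlib/Analysis/Calculus/InverseFunctionTheorem/ContDiff.lean`.
-/

noncomputable section

open scoped Topology ContDiff
open Filter

namespace Literature.Analysis.OperatorTheory

variable {𝔸 : Type*} [NormedRing 𝔸] [NormedAlgebra ℝ 𝔸] [CompleteSpace 𝔸]

set_option quotPrecheck false in
/-- The local square root near `1` (as in `LocalSqrtNearOneProofs.lean`). -/
local notation "√₁" => HasStrictFDerivAt.localInverse (fun X : 𝔸 ↦ X * X)
  (ContinuousLinearEquiv.smulLeft (Units.mk0 (2 : ℝ) two_ne_zero) : 𝔸 ≃L[ℝ] 𝔸) 1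
  hasStrictFDerivAt_mul_self_one

/-- **The square root is analytic at `1`** (inverse function theorem, analytic version: squaring is
a polynomial map). [folklore] -/
theorem contDiffAt_omega_localSqrt : ContDiffAt ℝ ω (fun X : 𝔸 ↦ √₁ X) 1 := by
  have hf : ContDiffAt ℝ ω (fun X : 𝔸 ↦ X * X) 1 := contDiffAt_id.mul contDiffAt_id
  have h := hf.to_localInverse (hasStrictFDerivAt_mul_self_one (𝔸 := 𝔸)).hasFDerivAt (by simp)
  simp only [ContDiffAt.localInverse, mul_one] at h
  exact h

/-- **The square root is `C^∞` at every point near `1`** (analyticity at `1` propagates to a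
neighbourhood). [folklore] -/
theorem eventually_contDiffAt_localSqrt : ∀ᶠ X in 𝓝 (1 : 𝔸), ContDiffAt ℝ ∞ (fun X : 𝔸 ↦ √₁ X) X :=
  (contDiffAt_omega_localSqrt.eventually (by simp)).mono fun _ h ↦ h.of_le le_top

/-- **Uniqueness ⇒ symmetry.** For an anti-homomorphism-like map `σ` (`σ 1 = 1`,
`σ (X * Y) = σ Y * σ X`, continuous at `1`; e.g. the adjoint with respect to an inner product or a
nondegenerate symmetric bilinear form), near `1`: if `σ X = X` then `σ (√X) = √X` — `σ √X` is a
square root of `σ X = X` close to `1`. [folklore] -/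
theorem eventually_localSqrt_fixed_of_antihom (σ : 𝔸 → 𝔸) (h1 : σ 1 = 1)
    (hm : ∀ X Y, σ (X * Y) = σ Y * σ X) (hc : ContinuousAt σ 1) :
    ∀ᶠ X in 𝓝 (1 : 𝔸), (σ X = X → σ (√₁ X) = √₁ X) := by
  have hcs : ContinuousAt (fun X : 𝔸 ↦ σ (√₁ X)) 1 := by
    have h' : ContinuousAt σ ((fun X : 𝔸 ↦ √₁ X) 1) := by
      simp only [localSqrt_one]
      exact hc
    exact ContinuousAt.comp h' continuousAt_localSqrt
  have ht : ∀ᶠ Y in 𝓝 ((fun X : 𝔸 ↦ σ (√₁ X)) 1), √₁ (Y * Y) = Y := by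
    simp only [localSqrt_one, h1]
    exact eventually_localSqrt_of_mul_self
  filter_upwards [hcs.eventually ht, eventually_localSqrt_mul_self (𝔸 := 𝔸)] with X hX hXX hsX
  have hY : σ (√₁ X) * σ (√₁ X) = X := by rw [← hm, hXX, hsX]
  rw [hY] at hX
  exact hX.symm

/-- **`√X` is invertible near `1`** (it is close to `√1 = 1` and the units are open). [folklore] -/
theorem eventually_isUnit_localSqrt : ∀ᶠ X in 𝓝 (1 : 𝔸), IsUnit (√₁ X) := by
  have h : ∀ᶠ Y in 𝓝 ((fun X : 𝔸 ↦ √₁ X) 1), IsUnit Y := by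
    simp only [localSqrt_one]
    exact Units.isOpen.mem_nhds isUnit_one
  exact continuousAt_localSqrt.eventually h

/-- **`√X * √X = X` and `√X` commutes with `X`** near `1` (both from `√X · √X = X`). [folklore] -/
theorem eventually_localSqrt_comm_self : ∀ᶠ X in 𝓝 (1 : 𝔸), √₁ X * X = X * √₁ X := by
  filter_upwards [eventually_localSqrt_mul_self (𝔸 := 𝔸)] with X hXX
  have h : √₁ X * (√₁ X * √₁ X) = (√₁ X * √₁ X) * √₁ X := by rw [mul_assoc]
  rwa [hXX] at h

end Literature.Analysis.OperatorTheory
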